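import Literature.NumberTheory.Automorphic.UnitaryGroupSymplecticFiniteAdelic
import Literature.NumberTheory.Automorphic.UnitaryGroupSymplecticCarriers
import HarnessLib

/-!
# Place components of the embedding `U(J)(𝔸_F) → Sp(𝕎_𝔸)`

Topic `NumberTheory/Automorphic`; namespace `Literature.NumberTheory.Automorphic.UnitaryGroup`. Kernel glue over the
constructed embeddings of `UnitaryGroupSymplecticCarriers` (Gelbart–Rogawski 1991 §3.1 `G(𝐀) ⊂ Sp_𝐀(W)`, `W = Res_{E/F} V`;
Mœglin–Vignéras–Waldspurger Ch. 1 I.17): the adelic embedding `adelicToSymplectic : U(J)(𝔸_F) →* Sp(𝔸_Fᴺ × 𝔸_Fᴺ)` and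
the local embeddings `localToSymplectic v : U(J)(F_v) →* Sp(F_vᴺ × F_vᴺ)` (`localPiToSymplectic v` on the factor form
`localPi`) are COMPATIBLE WITH LOCALISATION at every finite place `v` of `F`:

* §1 the quadratic coordinates commute with localisation: `(Ψ_𝔸 (a, b))|_v = Ψ_v (a_v, b_v)`
  (`adeleToLocal_quadraticAdeleEquiv`), hence `re_v (Z|_v) = (re_𝔸 Z)_v`, `im_v (Z|_v) = (im_𝔸 Z)_v`
  (`re_adeleToLocal`, `im_adeleToLocal`), and `(re_𝔸 Z)_∞`, `(im_𝔸 Z)_∞` depend only on `Z_∞`;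
* §2 **`adelicToSymplectic_apply_place`**: the `v`-components of `ι_𝔸(G) (x, y)` are `ι_v(G_v) (x_v, y_v)` with
  `G_v = toLocal v G ∈ U(J)(F_v)`; for `G = (1, g)` finite-adelic (`finAdelicToAdelic g`) this is
  `localPiToSymplectic v (evalPlace v g) (x_v, y_v)` (`adelicToSymplectic_finAdelicToAdelic_apply_place`);
* §3 for finite-adelic `g` the ARCHIMEDEAN components of `ι_𝔸(1, g) (x, y)` are those of `(x, y)`
  (`fst_adelicToSymplectic_finAdelicToAdelic_apply`);
* §4 the orbit maps `G ↦ ι_𝔸(G) w` are continuous (`continuous_adelicToSymplectic_apply`).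

This is the group-side input of the place-by-place assembly `⊗'_v ω_v` of the Weil representation restricted to
`U(J)(𝔸_{F,f})` [GelbartRogawski1991, §3.1 Prop. 3.1.1]. All statements proved; no named facts.
-/

noncomputable section

open Matrix NumberField IsDedekindDomain

namespace Literature.NumberTheory.Automorphic

namespace UnitaryGroup

open QuadraticCoordinates

variable (F : Type) [Field F] [NumberField F] (E : Type) [Field E] [NumberField E] [Algebra F E]
  [Algebra.IsQuadraticExtension F E] (c : E ≃ₐ[F] E) {δ : E} (hcδ : c δ = -δ) (hδ : δ ≠ 0)

/-! ## §1 Quadratic coordinates commute with localisation -/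

section Coordinates

/-- **`(Ψ_𝔸 (a, b))|_v = Ψ_v (a_v, b_v)`**: the adelic quadratic coordinates, read above a finite place `v`, are the local
ones. [cite: CasselsFrohlichANT1967, Ch. II §14] -/
theorem adeleToLocal_quadraticAdeleEquiv (v : HeightOneSpectrum (𝓞 F)) (p : AdeleRing (𝓞 F) F × AdeleRing (𝓞 F) F) :
    adeleToLocal E v (quadraticAdeleEquiv F E c hcδ hδ p) = quadraticLocalEquiv E v c hcδ hδ (p.1.2 v, p.2.2 v) := by
  funext w
  rw [adeleToLocal_apply, quadraticLocalEquiv_apply, ← quadraticLocalMap_apply,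
    ← finiteAdeleToLocal_quadraticFiniteAdeleMap E δ (p.1.2, p.2.2) v, finiteAdeleToLocal_apply]
  rfl

/-- `re_v (Ψ_v (a, b)) = a`. [folklore] -/
private theorem re_quadraticLocalEquiv (v : HeightOneSpectrum (𝓞 F)) (a b : v.adicCompletion F) :
    re (quadraticLocalEquiv E v c hcδ hδ).toLinearEquiv.toAddEquiv (quadraticLocalEquiv E v c hcδ hδ (a, b)) = a := by
  rw [re_def]
  exact congrArg Prod.fst ((quadraticLocalEquiv E v c hcδ hδ).symm_apply_apply (a, b))

/-- `im_v (Ψ_v (a, b)) = b`. [folklore] -/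
private theorem im_quadraticLocalEquiv (v : HeightOneSpectrum (𝓞 F)) (a b : v.adicCompletion F) :
    im (quadraticLocalEquiv E v c hcδ hδ).toLinearEquiv.toAddEquiv (quadraticLocalEquiv E v c hcδ hδ (a, b)) = b := by
  rw [im_def]
  exact congrArg Prod.snd ((quadraticLocalEquiv E v c hcδ hδ).symm_apply_apply (a, b))

/-- `re_𝔸 (Ψ_𝔸 p) = p.1`. [folklore] -/
private theorem re_quadraticAdeleEquiv (p : AdeleRing (𝓞 F) F × AdeleRing (𝓞 F) F) :
    re (quadraticAdeleEquiv F E c hcδ hδ).toAddEquiv (quadraticAdeleEquiv F E c hcδ hδ p) = p.1 := by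
  rw [re_def]
  exact congrArg Prod.fst ((quadraticAdeleEquiv F E c hcδ hδ).symm_apply_apply p)

/-- `im_𝔸 (Ψ_𝔸 p) = p.2`. [folklore] -/
private theorem im_quadraticAdeleEquiv (p : AdeleRing (𝓞 F) F × AdeleRing (𝓞 F) F) :
    im (quadraticAdeleEquiv F E c hcδ hδ).toAddEquiv (quadraticAdeleEquiv F E c hcδ hδ p) = p.2 := by
  rw [im_def]
  exact congrArg Prod.snd ((quadraticAdeleEquiv F E c hcδ hδ).symm_apply_apply p)

/-- **`re_v (Z|_v) = (re_𝔸 Z)_v`**: the first quadratic coordinate commutes with localisation. [cite: CasselsFrohlichANT1967, Ch. II §14] -/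
theorem re_adeleToLocal (v : HeightOneSpectrum (𝓞 F)) (Z : AdeleRing (𝓞 E) E) :
    re (quadraticLocalEquiv E v c hcδ hδ).toLinearEquiv.toAddEquiv (adeleToLocal E v Z) =
      (re (quadraticAdeleEquiv F E c hcδ hδ).toAddEquiv Z).2 v := by
  obtain ⟨p, rfl⟩ : ∃ p, Z = quadraticAdeleEquiv F E c hcδ hδ p :=
    ⟨_, ((quadraticAdeleEquiv F E c hcδ hδ).apply_symm_apply Z).symm⟩
  rw [adeleToLocal_quadraticAdeleEquiv, re_quadraticLocalEquiv, re_quadraticAdeleEquiv]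

/-- **`im_v (Z|_v) = (im_𝔸 Z)_v`**. [cite: CasselsFrohlichANT1967, Ch. II §14] -/
theorem im_adeleToLocal (v : HeightOneSpectrum (𝓞 F)) (Z : AdeleRing (𝓞 E) E) :
    im (quadraticLocalEquiv E v c hcδ hδ).toLinearEquiv.toAddEquiv (adeleToLocal E v Z) =
      (im (quadraticAdeleEquiv F E c hcδ hδ).toAddEquiv Z).2 v := by
  obtain ⟨p, rfl⟩ : ∃ p, Z = quadraticAdeleEquiv F E c hcδ hδ p :=
    ⟨_, ((quadraticAdeleEquiv F E c hcδ hδ).apply_symm_apply Z).symm⟩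
  rw [adeleToLocal_quadraticAdeleEquiv, im_quadraticLocalEquiv, im_quadraticAdeleEquiv]

/-- **`(re_𝔸 Z)_∞` depends only on `Z_∞`** (the archimedean part of `Ψ_𝔸⁻¹` is `Ψ_∞⁻¹`). [cite: CasselsFrohlichANT1967, Ch. II §14] -/
theorem fst_re_eq_of_fst_eq {Z Z' : AdeleRing (𝓞 E) E} (h : Z.1 = Z'.1) :
    (re (quadraticAdeleEquiv F E c hcδ hδ).toAddEquiv Z).1 = (re (quadraticAdeleEquiv F E c hcδ hδ).toAddEquiv Z').1 := by
  have h1 := congrArg Prod.fst (quadraticAdeleEquiv_symm_fst E c hcδ hδ Z)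
  have h2 := congrArg Prod.fst (quadraticAdeleEquiv_symm_fst E c hcδ hδ Z')
  rw [re_def, re_def]
  exact h1.trans ((congrArg (fun y => ((quadraticInfiniteAdeleEquiv F E
    (not_mem_range_algebraMap_of_apply_eq_neg E c hcδ hδ)).symm y).1) h).trans h2.symm)

/-- **`(im_𝔸 Z)_∞` depends only on `Z_∞`**. [cite: CasselsFrohlichANT1967, Ch. II §14] -/
theorem fst_im_eq_of_fst_eq {Z Z' : AdeleRing (𝓞 E) E} (h : Z.1 = Z'.1) :
    (im (quadraticAdeleEquiv F E c hcδ hδ).toAddEquiv Z).1 = (im (quadraticAdeleEquiv F E c hcδ hδ).toAddEquiv Z').1 := by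
  have h1 := congrArg Prod.snd (quadraticAdeleEquiv_symm_fst E c hcδ hδ Z)
  have h2 := congrArg Prod.snd (quadraticAdeleEquiv_symm_fst E c hcδ hδ Z')
  rw [im_def, im_def]
  exact h1.trans ((congrArg (fun y => ((quadraticInfiniteAdeleEquiv F E
    (not_mem_range_algebraMap_of_apply_eq_neg E c hcδ hδ)).symm y).2) h).trans h2.symm)

end Coordinates

/-! ## §2 Place components of `ι_𝔸(G) (x, y)` -/

section Place

variable (N : ℕ) {d : F} (hd : δ * δ = algebraMap F E d) {T : Matrix (Fin N) (Fin N) F} (hT : T.IsSymm)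
  {J : Matrix (Fin N) (Fin N) E} (hJ : J = T.map (algebraMap F E))

/-- the `v`-components of a pair of adelic vectors. [folklore] -/
def placeVec (v : HeightOneSpectrum (𝓞 F)) (w : (Fin N → AdeleRing (𝓞 F) F) × (Fin N → AdeleRing (𝓞 F) F)) :
    (Fin N → v.adicCompletion F) × (Fin N → v.adicCompletion F) :=
  (fun i => (w.1 i).2 v, fun i => (w.2 i).2 v)

/-- unfolding, first component. [cite: GelbartRogawski1991, §3.1 p. 454] -/
@[simp] theorem placeVec_fst (v : HeightOneSpectrum (𝓞 F)) (w : (Fin N → AdeleRing (𝓞 F) F) × (Fin N → AdeleRing (𝓞 F) F))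
    (i : Fin N) : (placeVec F N v w).1 i = (w.1 i).2 v := rfl

/-- unfolding, second component. [cite: GelbartRogawski1991, §3.1 p. 454] -/
@[simp] theorem placeVec_snd (v : HeightOneSpectrum (𝓞 F)) (w : (Fin N → AdeleRing (𝓞 F) F) × (Fin N → AdeleRing (𝓞 F) F))
    (i : Fin N) : (placeVec F N v w).2 i = (w.2 i).2 v := rfl

omit [Algebra.IsQuadraticExtension F E] in
/-- the local matrix of `G ∈ U(J)(𝔸_F)` at `v` acts on localised vectors by localising `G X`. [folklore] -/
private theorem toLocal_mulVec (v : HeightOneSpectrum (𝓞 F)) (G : adelic F E c N J) (X : Fin N → AdeleRing (𝓞 E) E) :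
    (((toLocal E c N J v G : «local» E c N J v) : GL (Fin N) (LocalRing E v)) : Matrix (Fin N) (Fin N) (LocalRing E v)) *ᵥ
        (fun i => adeleToLocal E v (X i)) =
      fun i => adeleToLocal E v ((((G : GL (Fin N) (AdeleRing (𝓞 E) E)) : Matrix (Fin N) (Fin N) (AdeleRing (𝓞 E) E)) *ᵥ X) i) := by
  funext i
  rw [RingHom.map_mulVec]
  rfl

/-- **`(ι_𝔸(G) (x, y))_v = ι_v(G_v) (x_v, y_v)`**: the adelic embedding `U(J)(𝔸_F) → Sp(𝕎_𝔸)` localises, at every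
finite place `v`, to the local embedding `U(J)(F_v) → Sp(𝕎_v)` at `G_v = toLocal v G`. [cite: GelbartRogawski1991, §3.1 p. 454] -/
theorem adelicToSymplectic_apply_place (v : HeightOneSpectrum (𝓞 F)) (G : adelic F E c N J)
    (w : (Fin N → AdeleRing (𝓞 F) F) × (Fin N → AdeleRing (𝓞 F) F)) :
    placeVec F N v ((adelicToSymplectic F E c N hcδ hδ hd hT hJ G).1 w) =
      (localToSymplectic E c N v hcδ hδ hd hT hJ (toLocal E c N J v G)).1 (placeVec F N v w) := by
  obtain ⟨X, rfl⟩ : ∃ X, w = reIm (quadraticAdeleEquiv F E c hcδ hδ).toAddEquiv (Fin N) X :=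
    ⟨_, (AddEquiv.apply_symm_apply _ w).symm⟩
  have hX : placeVec F N v (reIm (quadraticAdeleEquiv F E c hcδ hδ).toAddEquiv (Fin N) X) =
      reIm (quadraticLocalEquiv E v c hcδ hδ).toLinearEquiv.toAddEquiv (Fin N) (fun i => adeleToLocal E v (X i)) :=
    Prod.ext (funext fun i => (re_adeleToLocal F E c hcδ hδ v (X i)).symm)
      (funext fun i => (im_adeleToLocal F E c hcδ hδ v (X i)).symm)
  rw [hX, localToSymplectic_reIm, adelicToSymplectic_reIm, toLocal_mulVec]
  exact Prod.ext (funext fun i => (re_adeleToLocal F E c hcδ hδ v _).symm)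
    (funext fun i => (im_adeleToLocal F E c hcδ hδ v _).symm)

omit [Algebra.IsQuadraticExtension F E] in
/-- the `v`-component of a finite-adelic `g`, read on the matrix carrier: `localPiEquiv (evalPlace v g) = toLocal v (1, g)`.
[folklore] -/
private theorem localPiEquiv_evalPlace_eq (v : HeightOneSpectrum (𝓞 F)) (g : finAdelic F E c N J) :
    localPiEquiv E c N J v (evalPlace F E c N J v g) =
      toLocal E c N J v (finAdelicToAdelic F E c N J g : adelic F E c N J) :=
  Subtype.ext (localPiEquiv_evalPlace F E c N J v g)

/-- **`(ι_𝔸(1, g) (x, y))_v = ι_v(g_v) (x_v, y_v)`** for finite-adelic `g ∈ U(J)(𝔸_{F,f})`, with `g_v = evalPlace v g` on the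
factor form `localPi` and `ι_v = localPiToSymplectic v`. [cite: GelbartRogawski1991, §3.1 p. 454] -/
theorem adelicToSymplectic_finAdelicToAdelic_apply_place (v : HeightOneSpectrum (𝓞 F)) (g : finAdelic F E c N J)
    (w : (Fin N → AdeleRing (𝓞 F) F) × (Fin N → AdeleRing (𝓞 F) F)) :
    placeVec F N v ((adelicToSymplectic F E c N hcδ hδ hd hT hJ (finAdelicToAdelic F E c N J g : adelic F E c N J)).1 w) =
      (localPiToSymplectic E c N v hcδ hδ hd hT hJ (evalPlace F E c N J v g)).1 (placeVec F N v w) := by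
  rw [adelicToSymplectic_apply_place, ← localPiEquiv_evalPlace_eq]
  rfl

/-! ## §3 Finite-adelic elements do not move the archimedean components -/

omit [NumberField F] [Algebra.IsQuadraticExtension F E] in
/-- `((1, g) X)_∞ = X_∞`. [folklore] -/
private theorem fst_ofFinite_mulVec (g : GL (Fin N) (FiniteAdeleRing (𝓞 E) E)) (X : Fin N → AdeleRing (𝓞 E) E) (i : Fin N) :
    ((((GLn.ofFinite N E g : GL (Fin N) (AdeleRing (𝓞 E) E)) : Matrix (Fin N) (Fin N) (AdeleRing (𝓞 E) E)) *ᵥ X) i).1 =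
      (X i).1 := by
  change adeleFst E ((((GLn.ofFinite N E g : GL (Fin N) (AdeleRing (𝓞 E) E)) :
    Matrix (Fin N) (Fin N) (AdeleRing (𝓞 E) E)) *ᵥ X) i) = adeleFst E (X i)
  have hg' : ∀ j, adeleFst E (((GLn.ofFinite N E g : GL (Fin N) (AdeleRing (𝓞 E) E)) :
      Matrix (Fin N) (Fin N) (AdeleRing (𝓞 E) E)) i j) = (1 : Matrix (Fin N) (Fin N) (InfiniteAdeleRing E)) i j :=
    fun j => fst_coe_ofFinite_apply g i j
  rw [Matrix.mulVec, dotProduct, map_sum]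
  simp only [map_mul, hg', Matrix.one_apply, ite_mul, one_mul, zero_mul, Finset.sum_ite_eq, Finset.mem_univ,
    if_true]

/-- **for finite-adelic `g`, `ι_𝔸(1, g)` FIXES THE ARCHIMEDEAN COMPONENTS**: `(ι_𝔸(1, g) (x, y))_∞ = (x, y)_∞`
(both halves). [cite: BorelJacquet1979, §4.1] -/
theorem fst_adelicToSymplectic_finAdelicToAdelic_apply (g : finAdelic F E c N J)
    (w : (Fin N → AdeleRing (𝓞 F) F) × (Fin N → AdeleRing (𝓞 F) F)) (i : Fin N) :
    (((adelicToSymplectic F E c N hcδ hδ hd hT hJ (finAdelicToAdelic F E c N J g : adelic F E c N J)).1 w).1 i).1 = (w.1 i).1 ∧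
      (((adelicToSymplectic F E c N hcδ hδ hd hT hJ (finAdelicToAdelic F E c N J g : adelic F E c N J)).1 w).2 i).1 =
        (w.2 i).1 := by
  obtain ⟨X, rfl⟩ : ∃ X, w = reIm (quadraticAdeleEquiv F E c hcδ hδ).toAddEquiv (Fin N) X :=
    ⟨_, (AddEquiv.apply_symm_apply _ w).symm⟩
  rw [adelicToSymplectic_reIm]
  simp only [reIm_apply_fst, reIm_apply_snd]
  exact ⟨fst_re_eq_of_fst_eq F E c hcδ hδ (fst_ofFinite_mulVec E N g.1 X i),
    fst_im_eq_of_fst_eq F E c hcδ hδ (fst_ofFinite_mulVec E N g.1 X i)⟩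

/-! ## §4 Continuity of the orbit maps -/

omit [NumberField F] [Algebra.IsQuadraticExtension F E] in
/-- `G ↦ (G X)_i` is continuous on `U(J)(𝔸_F)`. [folklore] -/
private theorem continuous_mulVec_apply (X : Fin N → AdeleRing (𝓞 E) E) (i : Fin N) :
    Continuous fun G : adelic F E c N J => (((G : GL (Fin N) (AdeleRing (𝓞 E) E)) :
      Matrix (Fin N) (Fin N) (AdeleRing (𝓞 E) E)) *ᵥ X) i := by
  simp only [Matrix.mulVec, dotProduct]
  refine continuous_finsetSum _ fun j _ => Continuous.mul ?_ continuous_const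
  exact (Units.continuous_val.comp continuous_subtype_val).matrix_elem i j

/-- **the orbit maps `G ↦ ι_𝔸(G) w ∈ 𝔸_Fᴺ × 𝔸_Fᴺ` are continuous** on `U(J)(𝔸_F)` (adelic topology of the matrix
entries; `Ψ_𝔸⁻¹` is continuous). [cite: Weil1964, Chap. III n° 39 p. 189] -/
theorem continuous_adelicToSymplectic_apply (w : (Fin N → AdeleRing (𝓞 F) F) × (Fin N → AdeleRing (𝓞 F) F)) :
    Continuous fun G : adelic F E c N J => (adelicToSymplectic F E c N hcδ hδ hd hT hJ G).1 w := by
  obtain ⟨X, rfl⟩ : ∃ X, w = reIm (quadraticAdeleEquiv F E c hcδ hδ).toAddEquiv (Fin N) X :=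
    ⟨_, (AddEquiv.apply_symm_apply _ w).symm⟩
  simp only [adelicToSymplectic_reIm]
  have hre : Continuous (re (quadraticAdeleEquiv F E c hcδ hδ).toAddEquiv) :=
    continuous_re _ (quadraticAdeleEquiv F E c hcδ hδ).symm.continuous
  have him : Continuous (im (quadraticAdeleEquiv F E c hcδ hδ).toAddEquiv) :=
    continuous_im _ (quadraticAdeleEquiv F E c hcδ hδ).symm.continuous
  exact (continuous_pi fun i => hre.comp (continuous_mulVec_apply F E c N X i)).prodMk
    (continuous_pi fun i => him.comp (continuous_mulVec_apply F E c N X i))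

/-- the orbit maps of `ι_𝔸 ∘ (1, ·)` on `U(J)(𝔸_{F,f})` are continuous. [cite: Weil1964, Chap. III n° 39 p. 189] -/
theorem continuous_adelicToSymplectic_finAdelicToAdelic_apply
    (w : (Fin N → AdeleRing (𝓞 F) F) × (Fin N → AdeleRing (𝓞 F) F)) :
    Continuous fun g : finAdelic F E c N J =>
      (adelicToSymplectic F E c N hcδ hδ hd hT hJ (finAdelicToAdelic F E c N J g : adelic F E c N J)).1 w :=
  (continuous_adelicToSymplectic_apply F E c hcδ hδ N hd hT hJ w).comp (continuous_finAdelicToAdelic F E c N J)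

end Place

end UnitaryGroup

end Literature.NumberTheory.Automorphic

end
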